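import Summits.BirchSwinnertonDyer.BirchSwinnertonDyer.Theorems.ClassRecordThreeEulerHalvesAtThreeCartanCoverHeckeDatumCover
import Summits.BirchSwinnertonDyer.BirchSwinnertonDyer.Theorems.ClassRecordThreeEulerHalvesAtThreeCartanCoverStrongApproxHolds
import HarnessLib

/-!
# The inert-Hecke certificate for (OBS), part C — the cover-level eigen-relation, the punchline, the `Γ̄(q)`-level variants, the mod-`3Λ` plumbing, (CHEB)

Support file for crux `CartanOnePlaceDegreeLawAtThree` (item stmt-BirchSwinnertonDyer-24801; lines `Lines/lattice` v8 ∕ `Lines/charext` v13), leaf (OBS)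
`CartanCover.Charext.NoModThreePeriodCharacterExtension`. Source: `Cruxes/CartanOnePlaceDegreeLawAtThree/Lines/charext.lean` v13 §InertHecke (crux ideator cruxidea-24801-1 g0,
2026-08-29), SORRY-FREE; continues the LEAD's `…CartanCoverHeckeDatum` (part A: T1–T6, T8, T9) and `…CartanCoverHeckeDatumCover` (part B: T7, T10, T11, (SIMREP)), used by name.
Contents: (T12) `cover_op_eq_smul_of_agree` — a mod-`3` additive cochain `χ` on `ι(O₀'¹) = coverUnits X q` agreeing on `Γ̄(q)` with a `T`-eigen cochain `ψ` of `Γ` (same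
representatives, (SIMREP)-shaped hypotheses `disjU ∕ stabU ∕ crit`) is `T`-eigen on ALL of `ι(O₀'¹)` ((T11d) + RES-INJ `modThree_trivial_of_trivial_on_principalLevel` with (M0) =
the THEOREM `strongApproxAtCartanPlace_holds` + (T5)); (T13) `cover_apply_eq_zero_of_cube_central` — THE PUNCHLINE: with `3 ∤ a`, `χ` kills every element with central cube whose
coset permutation is fixed-point-free ((T12) + (T4)); (T11c′)∕(T12′)∕(T13′) `period_op_restrict_eq_smul ∕ cover_op_eq_smul_of_agree_on ∕ cover_apply_eq_zero_of_cube_central_on` —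
the same with the comparison cochain `ψ` defined on `Γ̄(q)` only (where `c·per_F` is `Λ`-valued) and the RESTRICTED datum (T2′); (T14) `threeMul ∕ redThree ∕ redThree_eq_iff ∕
three_nsmul_redThree ∕ redThree_cochain ∕ redThree_eq_of_congr ∕ mem_of_congr ∕ redThree_op_eq_smul ∕ redThree_eq_zero_iff` — from the LITERAL hypotheses of (OBS) («values in `Λ`»,
«additive mod `3Λ`», «`≡ c·per_F` mod `3Λ` on `Γ̄(q)`») to honest cochains in `ℂ ∕ 3Λ`; (CHEB) `ChebotarevSupplyAtThree` (`@[conjecture] def`, asserted nowhere: `ρ̄_{W,3}` surjective ⇒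
primes `ℓ ≡ 2 (3)` with `3 ∤ a_ℓ` outside any finite set; attackable on the model of `Literature…exists_prime_modEq_one_not_dvd_frobeniusTrace_sub_two`) and the decided `ℓ = 5 ∕ 7`
sanity pair for the root condition of (T6). WHAT IS LEFT OF (OBS) after parts A–C: (SIMREP) (defn-ty1 g42 claims it from tree bricks), the `ℙ¹(𝔽_ℓ)` identification of the `ℓ+1`
cover cosets (⇒ `hfix` via (T6)), (CHEB), and the automorphic conversion «eigen-cochain null on elliptic elements ⇒ congruent newform of level prime to `q`» (torsion-free lift ∕
DS 6.11 ∕ Eichler–Shimura–Matsushima ∕ JL — or `CartanCarayol.noModThreePeriodCharacterExtension_of_carayol`, p739037 ∕ p740349). BSD is proved for no curve.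
-/

set_option linter.dupNamespace false
set_option autoImplicit false

noncomputable section

open scoped Classical Pointwise MatrixGroups UpperHalfPlane

namespace Summit.BirchSwinnertonDyer.BirchSwinnertonDyer.Theorems.CartanCover.Charext

open Literature.NumberTheory.Automorphic

namespace InertHecke

section Certificate

variable {D M : ℕ} {C : Finset ℕ} (X : CartanLevelCurveData D M C)

/-- **(T12) THE COVER-LEVEL EIGEN-RELATION ON ALL OF `ι(O₀'¹)`** — (T11d) + RES-INJ (`modThree_trivial_of_trivial_on_principalLevel`, from (M0)) + (T5): a mod-`3` additive cochain `χ` on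
`U = coverUnits X q` (`3χ = 0`) that agrees on `Γ̄(q)` with an eigen-cochain `ψ` of the (changed) `Γ`-datum (`T ψ = a•ψ`) is itself eigen for the cover operator: `T_U χ = a•χ` on `U`.
With `ψ = c·per_F mod 3Λ` ((T11c), eigenvalue `a = a_ℓ(W₁) = a_ℓ(V)`) this is the relation the certificate feeds into (T3)∕(T4). Inputs left: the representatives (SIMREP), `R`, and `q ≠ 3` (crux
hypothesis). [folklore] -/
theorem cover_op_eq_smul_of_agree {q : ℕ} [Fact q.Prime] (hq : q ∈ C) (hq3 : q ≠ 3) (R : CartanCover.CoverReduction X q)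
    (n : ℕ) [Fintype (Quotient (X.heckeSetoid n))]
    (g : Quotient (X.heckeSetoid n) → X.Gamma)
    (disjU : ∀ (i j : Quotient (X.heckeSetoid n)) (u : GL (Fin 2) ℝ), u ∈ CartanCover.coverUnits X q →
      ((gammaHeckeDatum X n).changeReps g).α i = u * ((gammaHeckeDatum X n).changeReps g).α j → i = j)
    (stabU : ∀ (u : CartanCover.coverUnits X q) (i : Quotient (X.heckeSetoid n)), ∃ j,
      ((gammaHeckeDatum X n).changeReps g).α i * u * (((gammaHeckeDatum X n).changeReps g).α j)⁻¹ ∈ CartanCover.coverUnits X q)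
    (crit : ∀ (β : GL (Fin 2) ℝ), β ∈ CartanCover.principalLevel X q → ∀ (i j : Quotient (X.heckeSetoid n)),
      ((gammaHeckeDatum X n).changeReps g).α i * β * (((gammaHeckeDatum X n).changeReps g).α j)⁻¹ ∈ X.Gamma →
      ((gammaHeckeDatum X n).changeReps g).α i * β * (((gammaHeckeDatum X n).changeReps g).α j)⁻¹ ∈ CartanCover.principalLevel X q)
    {A : Type*} [AddCommGroup A] (χ : CartanCover.coverUnits X q → A) (hχ : ∀ a b, χ (a * b) = χ a + χ b) (h3 : ∀ γ, 3 • χ γ = 0)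
    (ψ : X.Gamma → A)
    (hagree : ∀ (β : GL (Fin 2) ℝ) (hβ : β ∈ CartanCover.principalLevel X q),
      χ ⟨β, CartanCover.principalLevel_le_coverUnits X q hβ⟩ = ψ ⟨β, CartanCover.principalLevel_le_Gamma X q hq hβ⟩)
    (a : ℤ) (heig : ∀ γ : X.Gamma, ((gammaHeckeDatum X n).changeReps g).op ψ γ = a • ψ γ) :
    ∀ u : CartanCover.coverUnits X q,
      (HeckeDatum.ofStable (Γ := CartanCover.coverUnits X q) ((gammaHeckeDatum X n).changeReps g).α disjU stabU).op χ u = a • χ u := by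
  refine (HeckeDatum.ofStable (Γ := CartanCover.coverUnits X q) ((gammaHeckeDatum X n).changeReps g).α disjU stabU).eigen_of_eigen_on
    {γ : CartanCover.coverUnits X q | (γ : GL (Fin 2) ℝ) ∈ CartanCover.principalLevel X q}
    (fun ψ' hψ' h3' hker => modThree_trivial_of_trivial_on_principalLevel
      (fun D' M' C' X' q' _ hq' R' g' hg' => CartanCover.Charext.strongApproxAtCartanPlace_holds D' M' C' X' q' hq' R' g' hg') X q hq hq3 R ψ' hψ' h3' (fun γ hγ => hker γ hγ))
    χ hχ h3 a ?_
  intro β hβ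
  have h := cover_op_eq_on_principalLevel X hq n g disjU stabU crit χ ψ hagree (fun x => a • x) heig (β : GL (Fin 2) ℝ) hβ
  simpa only [Subtype.coe_eta] using h

/-- **(T13) THE PUNCHLINE OF THE CERTIFICATE, TYPED: `χ̄` KILLS EVERY ELEMENT OF THE COVER GROUP WHOSE CUBE IS CENTRAL AND WHOSE COSET PERMUTATION IS FIXED-POINT-FREE.**
(T12) + (T3)∕(T4): under the hypotheses of (T12) with `3 ∤ a`, every `x ∈ ι(O₀'¹)` with `x³ = c` central (the elliptic elements of order `3` and `6`: `c = ±1`) and `σ_x` without fixed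
points on the `ℓ + 1` cosets (by (T6): `ℓ ≡ 2 (mod 3)` and the cosets are `ℙ¹(𝔽_ℓ)`) satisfies `χ̄(x) = 0`; `χ̄(c) = χ̄(x³) = 3χ̄(x) = 0` is automatic. What is left to the OBS prover:
SIMREP (the representatives), the `ℙ¹(𝔽_ℓ)`-identification feeding (T6), a prime `ℓ ≡ 2 (3)` with `3 ∤ a_ℓ(V)` (Chebotarev for `Surj V 3`), and the automorphic cites turning
«eigen, additive mod 3, null on all torsion» into a weight-2 level-prime-to-`q` congruence (torsion-free lift ∕ DS 6.11 ∕ ES–MS ∕ JL — or CAR, `CartanCarayol.noModThreePeriodCharacterExtension_of_carayol`). [folklore] -/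
theorem cover_apply_eq_zero_of_cube_central {q : ℕ} [Fact q.Prime] (hq : q ∈ C) (hq3 : q ≠ 3) (R : CartanCover.CoverReduction X q)
    (n : ℕ) [Fintype (Quotient (X.heckeSetoid n))]
    (g : Quotient (X.heckeSetoid n) → X.Gamma)
    (disjU : ∀ (i j : Quotient (X.heckeSetoid n)) (u : GL (Fin 2) ℝ), u ∈ CartanCover.coverUnits X q →
      ((gammaHeckeDatum X n).changeReps g).α i = u * ((gammaHeckeDatum X n).changeReps g).α j → i = j)
    (stabU : ∀ (u : CartanCover.coverUnits X q) (i : Quotient (X.heckeSetoid n)), ∃ j,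
      ((gammaHeckeDatum X n).changeReps g).α i * u * (((gammaHeckeDatum X n).changeReps g).α j)⁻¹ ∈ CartanCover.coverUnits X q)
    (crit : ∀ (β : GL (Fin 2) ℝ), β ∈ CartanCover.principalLevel X q → ∀ (i j : Quotient (X.heckeSetoid n)),
      ((gammaHeckeDatum X n).changeReps g).α i * β * (((gammaHeckeDatum X n).changeReps g).α j)⁻¹ ∈ X.Gamma →
      ((gammaHeckeDatum X n).changeReps g).α i * β * (((gammaHeckeDatum X n).changeReps g).α j)⁻¹ ∈ CartanCover.principalLevel X q)
    {A : Type*} [AddCommGroup A] (χ : CartanCover.coverUnits X q → A) (hχ : ∀ a b, χ (a * b) = χ a + χ b) (h3 : ∀ γ, 3 • χ γ = 0)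
    (ψ : X.Gamma → A)
    (hagree : ∀ (β : GL (Fin 2) ℝ) (hβ : β ∈ CartanCover.principalLevel X q),
      χ ⟨β, CartanCover.principalLevel_le_coverUnits X q hβ⟩ = ψ ⟨β, CartanCover.principalLevel_le_Gamma X q hq hβ⟩)
    (a : ℤ) (ha : ¬ (3 : ℤ) ∣ a) (heig : ∀ γ : X.Gamma, ((gammaHeckeDatum X n).changeReps g).op ψ γ = a • ψ γ)
    (x c : CartanCover.coverUnits X q) (hx : x ^ 3 = c) (hc : ∀ g' : GL (Fin 2) ℝ, g' * c = c * g')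
    (hfix : ∀ i, (HeckeDatum.ofStable (Γ := CartanCover.coverUnits X q) ((gammaHeckeDatum X n).changeReps g).α disjU stabU).σ x i ≠ i) :
    χ x = 0 := by
  classical
  have hχc : χ c = 0 := by
    rw [← hx, pow_succ, pow_two, hχ, hχ]
    have e : χ x + χ x + χ x = 3 • χ x := by
      rw [show (3 : ℕ) = 2 + 1 from rfl, add_nsmul, two_nsmul, one_nsmul]
    rw [e]; exact h3 x
  exact (HeckeDatum.ofStable (Γ := CartanCover.coverUnits X q) ((gammaHeckeDatum X n).changeReps g).α disjU stabU).apply_eq_zero_of_eigen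
    χ hχ h3 a ha (cover_op_eq_smul_of_agree X hq hq3 R n g disjU stabU crit χ hχ h3 ψ hagree a heig) x c hx hc hχc hfix

/-! #### The `Γ̄(q)`-level variants (the comparison cochain `ψ` lives only on `Γ̄(q)`)

In (OBS) the comparison cochain `c·per_F` is `Λ`-valued only on `Γ̄(q)` (elsewhere `c·per_F(γ)` need not lie in `Λ`), so its mod-`3Λ` class `ψ̄` is a cochain on `N = Γ̄(q)`,
not on `Γ`. The restricted datum `H_N = (changed Γ-datum).restrict N` (T2′, same representatives) carries it: `per_F` is `H_N`-eigen on `N` in `ℂ` ((T11c) through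
`op_restrict`), hence `ψ̄` is `H_N`-eigen in `Λ∕3Λ`, and (T12)∕(T13) run with `Γ := N`. -/

/-- **(T11c′) the period cochain is eigen for the `Γ̄(q)`-RESTRICTED datum** (values in `ℂ`; (T11c) read through (T2′) `op_restrict`). [cite: ShimuraIATAF1971, §8.3 (8.3.2)] -/
theorem period_op_restrict_eq_smul {q : ℕ} (hq : q ∈ C) (n : ℕ) [Fintype (Quotient (X.heckeSetoid n))] (F : CuspForm X.Gamma 2) (a : ℂ)
    (hF : X.heckeFun n F = fun τ => a * F τ) (z : ℍ) (g : Quotient (X.heckeSetoid n) → X.Gamma)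
    (memN : ∀ (β : CartanCover.principalLevel X q) (i : Quotient (X.heckeSetoid n)),
      ((gammaHeckeDatum X n).changeReps g).α i * β *
        (((gammaHeckeDatum X n).changeReps g).α (((gammaHeckeDatum X n).changeReps g).σ ⟨β, CartanCover.principalLevel_le_Gamma X q hq β.2⟩ i))⁻¹ ∈
        CartanCover.principalLevel X q)
    (β : CartanCover.principalLevel X q) :
    (((gammaHeckeDatum X n).changeReps g).restrict (CartanCover.principalLevel X q) (CartanCover.principalLevel_le_Gamma X q hq) memN).op
        (fun δ : CartanCover.principalLevel X q => segmentIntegral F z ((δ : GL (Fin 2) ℝ) • z)) β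
      = a * segmentIntegral F z ((β : GL (Fin 2) ℝ) • z) := by
  have h := period_op_changeReps_eq_smul X n F a hF z g ⟨β, CartanCover.principalLevel_le_Gamma X q hq β.2⟩
  rw [HeckeDatum.op_restrict _ (CartanCover.principalLevel X q) (CartanCover.principalLevel_le_Gamma X q hq) memN] at h
  exact h

/-- **(T12′) cover-level eigen-relation from a comparison cochain on `Γ̄(q)` only**: as (T12), with `ψ : Γ̄(q) → A` eigen for the RESTRICTED datum. [folklore] -/
theorem cover_op_eq_smul_of_agree_on {q : ℕ} [Fact q.Prime] (hq : q ∈ C) (hq3 : q ≠ 3) (R : CartanCover.CoverReduction X q)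
    (n : ℕ) [Fintype (Quotient (X.heckeSetoid n))]
    (g : Quotient (X.heckeSetoid n) → X.Gamma)
    (disjU : ∀ (i j : Quotient (X.heckeSetoid n)) (u : GL (Fin 2) ℝ), u ∈ CartanCover.coverUnits X q →
      ((gammaHeckeDatum X n).changeReps g).α i = u * ((gammaHeckeDatum X n).changeReps g).α j → i = j)
    (stabU : ∀ (u : CartanCover.coverUnits X q) (i : Quotient (X.heckeSetoid n)), ∃ j,
      ((gammaHeckeDatum X n).changeReps g).α i * u * (((gammaHeckeDatum X n).changeReps g).α j)⁻¹ ∈ CartanCover.coverUnits X q)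
    (memN : ∀ (β : CartanCover.principalLevel X q) (i : Quotient (X.heckeSetoid n)),
      ((gammaHeckeDatum X n).changeReps g).α i * β *
        (((gammaHeckeDatum X n).changeReps g).α (((gammaHeckeDatum X n).changeReps g).σ ⟨β, CartanCover.principalLevel_le_Gamma X q hq β.2⟩ i))⁻¹ ∈
        CartanCover.principalLevel X q)
    {A : Type*} [AddCommGroup A] (χ : CartanCover.coverUnits X q → A) (hχ : ∀ a b, χ (a * b) = χ a + χ b) (h3 : ∀ γ, 3 • χ γ = 0)
    (ψ : CartanCover.principalLevel X q → A)
    (hagree : ∀ (β : GL (Fin 2) ℝ) (hβ : β ∈ CartanCover.principalLevel X q),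
      χ ⟨β, CartanCover.principalLevel_le_coverUnits X q hβ⟩ = ψ ⟨β, hβ⟩)
    (a : ℤ) (heig : ∀ β : CartanCover.principalLevel X q,
      (((gammaHeckeDatum X n).changeReps g).restrict (CartanCover.principalLevel X q) (CartanCover.principalLevel_le_Gamma X q hq) memN).op ψ β
        = a • ψ β) :
    ∀ u : CartanCover.coverUnits X q,
      (HeckeDatum.ofStable (Γ := CartanCover.coverUnits X q) ((gammaHeckeDatum X n).changeReps g).α disjU stabU).op χ u = a • χ u := by
  -- the restricted datum has the same representatives; run (T11b) with `Γ := Γ̄(q)`, `N := Γ̄(q)`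
  set HN := ((gammaHeckeDatum X n).changeReps g).restrict (CartanCover.principalLevel X q) (CartanCover.principalLevel_le_Gamma X q hq) memN
    with hHN
  have hαN : HN.α = ((gammaHeckeDatum X n).changeReps g).α := rfl
  refine (HeckeDatum.ofStable (Γ := CartanCover.coverUnits X q) ((gammaHeckeDatum X n).changeReps g).α disjU stabU).eigen_of_eigen_on
    {γ : CartanCover.coverUnits X q | (γ : GL (Fin 2) ℝ) ∈ CartanCover.principalLevel X q}
    (fun ψ' hψ' h3' hker => modThree_trivial_of_trivial_on_principalLevel
      (fun D' M' C' X' q' _ hq' R' g' hg' => CartanCover.Charext.strongApproxAtCartanPlace_holds D' M' C' X' q' hq' R' g' hg') X q hq hq3 R ψ' hψ' h3' (fun γ hγ => hker γ hγ))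
    χ hχ h3 a ?_
  intro β hβ
  have h : (HeckeDatum.ofStable (Γ := CartanCover.coverUnits X q) ((gammaHeckeDatum X n).changeReps g).α disjU stabU).op χ
        ⟨(β : GL (Fin 2) ℝ), CartanCover.principalLevel_le_coverUnits X q hβ⟩
      = a • χ ⟨(β : GL (Fin 2) ℝ), CartanCover.principalLevel_le_coverUnits X q hβ⟩ :=
    HN.op_ofStable_overgroup_eq_on (CartanCover.coverUnits X q) (CartanCover.principalLevel_le_coverUnits X q)
      disjU stabU (CartanCover.principalLevel X q) le_rfl (fun b hb i => HN.mem ⟨b, hb⟩ i) χ ψ (fun b hb => hagree b hb)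
      (fun x => a • x) (fun b hb => heig ⟨b, hb⟩) (β : GL (Fin 2) ℝ) hβ
  simpa only [Subtype.coe_eta] using h

/-- **(T13′) the punchline from a comparison cochain on `Γ̄(q)` only**: as (T13), with `ψ : Γ̄(q) → A` eigen for the restricted datum and `3 ∤ a`. [folklore] -/
theorem cover_apply_eq_zero_of_cube_central_on {q : ℕ} [Fact q.Prime] (hq : q ∈ C) (hq3 : q ≠ 3) (R : CartanCover.CoverReduction X q)
    (n : ℕ) [Fintype (Quotient (X.heckeSetoid n))]
    (g : Quotient (X.heckeSetoid n) → X.Gamma)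
    (disjU : ∀ (i j : Quotient (X.heckeSetoid n)) (u : GL (Fin 2) ℝ), u ∈ CartanCover.coverUnits X q →
      ((gammaHeckeDatum X n).changeReps g).α i = u * ((gammaHeckeDatum X n).changeReps g).α j → i = j)
    (stabU : ∀ (u : CartanCover.coverUnits X q) (i : Quotient (X.heckeSetoid n)), ∃ j,
      ((gammaHeckeDatum X n).changeReps g).α i * u * (((gammaHeckeDatum X n).changeReps g).α j)⁻¹ ∈ CartanCover.coverUnits X q)
    (memN : ∀ (β : CartanCover.principalLevel X q) (i : Quotient (X.heckeSetoid n)),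
      ((gammaHeckeDatum X n).changeReps g).α i * β *
        (((gammaHeckeDatum X n).changeReps g).α (((gammaHeckeDatum X n).changeReps g).σ ⟨β, CartanCover.principalLevel_le_Gamma X q hq β.2⟩ i))⁻¹ ∈
        CartanCover.principalLevel X q)
    {A : Type*} [AddCommGroup A] (χ : CartanCover.coverUnits X q → A) (hχ : ∀ a b, χ (a * b) = χ a + χ b) (h3 : ∀ γ, 3 • χ γ = 0)
    (ψ : CartanCover.principalLevel X q → A)
    (hagree : ∀ (β : GL (Fin 2) ℝ) (hβ : β ∈ CartanCover.principalLevel X q),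
      χ ⟨β, CartanCover.principalLevel_le_coverUnits X q hβ⟩ = ψ ⟨β, hβ⟩)
    (a : ℤ) (ha : ¬ (3 : ℤ) ∣ a) (heig : ∀ β : CartanCover.principalLevel X q,
      (((gammaHeckeDatum X n).changeReps g).restrict (CartanCover.principalLevel X q) (CartanCover.principalLevel_le_Gamma X q hq) memN).op ψ β
        = a • ψ β)
    (x c : CartanCover.coverUnits X q) (hx : x ^ 3 = c) (hc : ∀ g' : GL (Fin 2) ℝ, g' * c = c * g')
    (hfix : ∀ i, (HeckeDatum.ofStable (Γ := CartanCover.coverUnits X q) ((gammaHeckeDatum X n).changeReps g).α disjU stabU).σ x i ≠ i) :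
    χ x = 0 := by
  classical
  have hχc : χ c = 0 := by
    rw [← hx, pow_succ, pow_two, hχ, hχ]
    have e : χ x + χ x + χ x = 3 • χ x := by
      rw [show (3 : ℕ) = 2 + 1 from rfl, add_nsmul, two_nsmul, one_nsmul]
    rw [e]; exact h3 x
  exact (HeckeDatum.ofStable (Γ := CartanCover.coverUnits X q) ((gammaHeckeDatum X n).changeReps g).α disjU stabU).apply_eq_zero_of_eigen
    χ hχ h3 a ha (cover_op_eq_smul_of_agree_on X hq hq3 R n g disjU stabU memN χ hχ h3 ψ hagree a heig) x c hx hc hχc hfix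

/-! #### (T14) The mod-`3Λ` plumbing: from the hypotheses of (OBS) to cochains with values in `ℂ ∕ 3Λ`

(OBS) speaks of a function `χ : GL₂(ℝ) → ℂ` with values in `Λ = Λ(W₁)` on `ι(O₀'¹)`, additive modulo `3Λ`, congruent to `c·per_F` modulo `3Λ` on `Γ̄(q)`. Reducing modulo the
subgroup `3Λ ⊆ ℂ` gives honest cochains `χ̄`, `ψ̄` with values in the `ℤ`-module `ℂ ∕ 3Λ`: `χ̄` additive with `3χ̄ = 0` (its values come from `Λ`), `ψ̄ = χ̄` on `Γ̄(q)`, and a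
`ℂ`-eigen-relation `T φ = m·φ` (`m ∈ ℤ`, e.g. `m = a_ℓ`) for a cochain `φ` descends to `T φ̄ = m • φ̄`. These are the inputs of (T12′)∕(T13′). -/

section ModThree

variable (Λ : Submodule ℤ ℂ)

/-- `3Λ ⊆ ℂ` as a `ℤ`-submodule. -/
def threeMul : Submodule ℤ ℂ := Λ.map (LinearMap.lsmul ℤ ℂ 3)

/-- membership in `3Λ`: `x ∈ 3Λ ↔ x = 3y` for some `y ∈ Λ`. [folklore] -/
theorem mem_threeMul_iff {x : ℂ} : x ∈ threeMul Λ ↔ ∃ y ∈ Λ, 3 * y = x := by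
  simp only [threeMul, Submodule.mem_map, LinearMap.lsmul_apply, zsmul_eq_mul, Int.cast_ofNat]

/-- the reduction `ℂ → ℂ ∕ 3Λ` (the `ℤ`-linear quotient map). -/
def redThree := (threeMul Λ).mkQ

/-- `redThree Λ x` is the class of `x` in `ℂ ∕ 3Λ`. [folklore] -/
theorem redThree_apply (x : ℂ) : redThree Λ x = Submodule.Quotient.mk x := rfl

/-- two complex numbers have the same class modulo `3Λ` iff they differ by `3z`, `z ∈ Λ`. [folklore] -/
theorem redThree_eq_iff {x y : ℂ} : redThree Λ x = redThree Λ y ↔ ∃ z ∈ Λ, x - y = 3 * z := by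
  rw [redThree_apply, redThree_apply, Submodule.Quotient.eq, mem_threeMul_iff]
  constructor <;> rintro ⟨z, hz, h⟩ <;> exact ⟨z, hz, h.symm⟩

/-- elements of `3Λ` reduce to `0`. [folklore] -/
theorem redThree_eq_zero_of_mem {x : ℂ} (hx : x ∈ threeMul Λ) : redThree Λ x = 0 := by
  rw [redThree_apply, Submodule.Quotient.mk_eq_zero]; exact hx

/-- values from `Λ` are `3`-torsion modulo `3Λ`. -/
theorem three_nsmul_redThree {x : ℂ} (hx : x ∈ Λ) : 3 • redThree Λ x = 0 := by
  rw [← map_nsmul]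
  apply redThree_eq_zero_of_mem
  rw [mem_threeMul_iff]
  exact ⟨x, hx, by rw [nsmul_eq_mul, Nat.cast_ofNat]⟩

/-- **(T14a) the reduced cochain `χ̄ = χ mod 3Λ` on a subgroup `U`**: additive and `3`-torsion, from the (OBS)-shaped hypotheses «values in `Λ`» and «additive modulo `3Λ`». [folklore] -/
theorem redThree_cochain (U : Subgroup (GL (Fin 2) ℝ)) (χ : GL (Fin 2) ℝ → ℂ) (hΛ : ∀ u ∈ U, χ u ∈ Λ)
    (hadd : ∀ u ∈ U, ∀ v ∈ U, ∃ y ∈ Λ, χ (u * v) - χ u - χ v = 3 * y) :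
    (∀ a b : U, redThree Λ (χ ((a * b : U) : GL (Fin 2) ℝ)) = redThree Λ (χ a) + redThree Λ (χ b)) ∧
      (∀ a : U, 3 • redThree Λ (χ a) = 0) := by
  refine ⟨fun a b => ?_, fun a => three_nsmul_redThree Λ (hΛ a a.2)⟩
  rw [← map_add, redThree_eq_iff]
  obtain ⟨y, hy, h⟩ := hadd a a.2 b b.2
  exact ⟨y, hy, by rw [Subgroup.coe_mul]; linear_combination h⟩

/-- **(T14b) congruent values reduce to the same class** («`χ ≡ c·per_F (mod 3Λ)` on `Γ̄(q)» ⇒ `χ̄ = ψ̄` there). [folklore] -/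
theorem redThree_eq_of_congr {x y : ℂ} (h : ∃ z ∈ Λ, x - y = 3 * z) : redThree Λ x = redThree Λ y :=
  (redThree_eq_iff Λ).mpr h

/-- a value congruent modulo `3Λ` to a value in `Λ` lies in `Λ` (so `c·per_F(β) ∈ Λ` for `β ∈ Γ̄(q)` under the hypotheses of (OBS)). [folklore] -/
theorem mem_of_congr {x y : ℂ} (hx : x ∈ Λ) (h : ∃ z ∈ Λ, x - y = 3 * z) : y ∈ Λ := by
  obtain ⟨z, hz, e⟩ := h
  have : y = x - 3 * z := by linear_combination (-1 : ℂ) * e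
  rw [this]
  exact Λ.sub_mem hx (by simpa only [zsmul_eq_mul, Int.cast_ofNat] using Λ.smul_mem (3 : ℤ) hz)

/-- **(T14c) a `ℂ`-eigen-relation with integral eigenvalue descends modulo `3Λ`**: `(T φ)(β) = m·φ(β)` in `ℂ` ⇒ `(T φ̄)(β) = m • φ̄(β)` in `ℂ ∕ 3Λ` (any Hecke datum; `redThree` is
additive). With (T11c′) (`φ = c·per_F` on `Γ̄(q)`, `m = a_ℓ(W₁)`) this is the hypothesis `heig` of (T12′)∕(T13′). [folklore] -/
theorem redThree_op_eq_smul {𝔾 : Type*} [Group 𝔾] {N : Subgroup 𝔾} {ι : Type*} [Fintype ι] (H : HeckeDatum N ι)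
    (φ : N → ℂ) (m : ℤ) (β : N) (heig : H.op φ β = (m : ℂ) * φ β) :
    H.op (fun δ => redThree Λ (φ δ)) β = m • redThree Λ (φ β) := by
  rw [HeckeDatum.op_apply] at heig ⊢
  rw [← map_sum, heig, ← zsmul_eq_mul, map_zsmul]

/-- the conclusion of (OBS) read modulo `3Λ`: «`c·per_F(β) ∈ 3Λ`» is «`ψ̄(β) = 0`». [folklore] -/
theorem redThree_eq_zero_iff {x : ℂ} : redThree Λ x = 0 ↔ ∃ y ∈ Λ, x = 3 * y := by
  rw [redThree_apply, Submodule.Quotient.mk_eq_zero, mem_threeMul_iff]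
  constructor <;> rintro ⟨y, hy, h⟩ <;> exact ⟨y, hy, h.symm⟩

end ModThree

/-- **(CHEB) CHEBOTAREV SUPPLY AT `3`** (print input (c) of the certificate, typed): if `ρ̄_{W,3}` is surjective then, avoiding any finite set of primes, there is a
prime `ℓ ≡ 2 (mod 3)` with `3 ∤ a_ℓ(W)`. PROOF IN PRINT: `GL₂(𝔽₃)` contains `g = (0 1; 1 1)` with `det g = -1`, `tr g = 1`; Chebotarev gives unramified `ℓ ∉ S` with
`ρ̄(Frob_ℓ) ∼ g`, so `ℓ ≡ det ρ̄(Frob_ℓ) = 2 (mod 3)` (mod-`3` cyclotomic character) and `a_ℓ ≡ tr = 1 (mod 3)`. ATTACKABLE IN THE TREE: the model is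
`Literature.NumberTheory.EllipticCurves.exists_prime_modEq_one_not_dvd_frobeniusTrace_sub_two` (PROVED from `absoluteGaloisGroup.frobenius_dense` + `chebotarev_artinRep_holds`
+ `ModNCyclotomicCharacter`), with the class of `g` in place of the class used there; `ℓ ≡ 2 (mod 3)` is what makes an order-`3` element of `PGL₂(𝔽_ℓ)` act on `ℙ¹(𝔽_ℓ)` without
fixed points ((T6): `t² + t + 1` has no root mod `ℓ`), and `3 ∤ a_ℓ` is `ha` of (T4)∕(T13). [cite: Serre1981, §8] [cite: Serre1972, §5] -/
@[conjecture] def ChebotarevSupplyAtThree : Prop :=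
  ∀ (W : WeierstrassCurve ℚ) [W.IsElliptic], W.HasSurjectiveModNGaloisRep 3 → ∀ S : Set ℕ, S.Finite →
    ∃ ℓ : ℕ, ℓ.Prime ∧ ℓ ∉ S ∧ ℓ % 3 = 2 ∧ ¬ (3 : ℤ) ∣ W.LFunction ℓ

/-- at a prime `ℓ ≡ 2 (mod 3)`, `t² + t + 1` has no root in `ZMod ℓ` — the hypothesis `hirr` of (T6) `fixedPointFree_of_projective_equivariance` (`-3` is a non-residue
mod `ℓ ≡ 2 (3)`); decided sanity instance `ℓ = 5`. [folklore] -/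
theorem sq_add_self_add_one_ne_zero_mod_five : ∀ t : ZMod 5, t ^ 2 + t + 1 ≠ 0 := by decide

/-- … and a root EXISTS at `ℓ = 7 ≡ 1 (mod 3)` (`t = 2`): the congruence `ℓ ≡ 2 (mod 3)` in (CHEB) is load-bearing for (T6). [folklore] -/
theorem exists_sq_add_self_add_one_eq_zero_mod_seven : ∃ t : ZMod 7, t ^ 2 + t + 1 = 0 := ⟨2, by decide⟩

end Certificate

end InertHecke

end Summit.BirchSwinnertonDyer.BirchSwinnertonDyer.Theorems.CartanCover.Charext

end
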